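import Literature.Analysis.FluidPDE.SereginSverakNoConcentration
import Literature.Analysis.FluidPDE.SuitableWeakProofs
import Literature.Analysis.FluidPDE.AncientMildWeakStar
import Literature.Analysis.FluidPDE.AxisymmetricEuler
import HarnessLib

/-!
# Route `AxisTwistDoor`, crux `AveragedConeLiouville` (stmt-NavierStokesRegularity-26889) — INPUT N3 (`ShellFact` by the
# compactness–contradiction route), piece S3: THE RADIAL GAP OF A COMPACT `𝒫¹`-NULL SET

N3 cut of record (pub/ns-inputs STATUS 2026-08-28T12:41:44Z; texts `kits/N3-skeleton.lean` 815f0a7c119d2985, `Sig.radialGap`).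
A compact `𝒫¹`-null set `S ⊂ ℝ × ℝ³` (in the assembly: the slab-singular set of the compactness limit inside the compact
shell box) misses a whole radial band: for `α < β` there are `a`, `δ > 0` with `α < a − 2δ < a + 2δ < β` and
`cylRadius x ∉ [a − 2δ, a + 2δ]` for every `(t,x) ∈ S`.  Proof: the radial image `N = {cylRadius x : (t,x) ∈ S} ⊂ ℝ` is compact
(continuity of `cylRadius`) and Lebesgue-null (a cover of `S` by centred parabolic cylinders `Q*_{rᵢ}(zᵢ)` with `∑ rᵢ < η`
projects to a cover of `N` by intervals of length `2rᵢ`, because `cylRadius` is `1`-Lipschitz), so the open set `]α,β[ ∖ N` is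
non-empty (it has positive measure) and contains a closed interval `[a − 2δ, a + 2δ]`.

* **`radialGap`** — the piece (`Sig.radialGap` verbatim);
* `isParabolicNull_union` — the union of two `𝒫^s`-null sets is null (for the assembly's `Σ♭ ⊆ singularSet u ↑slab ∪ lid-set`;
  monotonicity is the tree's `IsParabolicNull.mono`).

Pure measure theory; no NS statement is proved; N3 is an INPUT toward `ShellFact`; item 26889 and the summit stay OPEN.
`--supports stmt-NavierStokesRegularity-26889 --as helper`. [folklore]
-/

noncomputable section

-- the summit and its single sub-problem share the name (CONVENTIONS §1)
set_option linter.dupNamespace false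

open MeasureTheory Set Function Metric Filter Topology
open scoped NNReal ENNReal

namespace Summit.NavierStokesRegularity.NavierStokesRegularity.Theorems.AveragedConeLiouville.Shell

open Literature.Analysis Literature.Analysis.FluidPDE

/-- **The union of two `𝒫^s`-null sets is `𝒫^s`-null** (subadditivity `parabolicHausdorff_union_le_holds`). [folklore] -/
theorem isParabolicNull_union {s : ℝ} {X Y : Set (ℝ × EuclideanSpace ℝ (Fin 3))} (hX : IsParabolicNull s X)
    (hY : IsParabolicNull s Y) : IsParabolicNull s (X ∪ Y) := by
  unfold IsParabolicNull at *
  have h := parabolicHausdorff_union_le_holds (F := EuclideanSpace ℝ (Fin 3)) s X Y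
  rw [hX, hY, add_zero] at h
  exact le_antisymm h bot_le

/-- The radial image of a centred parabolic cylinder lies in an interval of length `2r` (`cylRadius` is `1`-Lipschitz). [folklore] -/
theorem cylRadius_image_cylinder_subset (r : ℝ) (z : ℝ × EuclideanSpace ℝ (Fin 3)) :
    (fun w : ℝ × EuclideanSpace ℝ (Fin 3) => cylRadius w.2) '' parabolicCylinderCentered r z ⊆
      Icc (cylRadius z.2 - r) (cylRadius z.2 + r) := by
  rintro _ ⟨w, hw, rfl⟩
  have hx : ‖w.2 - z.2‖ < r := by
    have h := hw.2
    rwa [mem_ball, dist_eq_norm] at h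
  have h1 := cylRadius_le_cylRadius_add_norm_sub z.2 w.2
  have h2 := cylRadius_le_cylRadius_add_norm_sub w.2 z.2
  rw [norm_sub_rev] at h2
  constructor <;> simp only <;> linarith

/-- **The radial image of a `𝒫¹`-null set is Lebesgue-null.** [folklore] -/
theorem volume_cylRadius_image_eq_zero {S : Set (ℝ × EuclideanSpace ℝ (Fin 3))} (hS : IsParabolicNull 1 S) :
    volume ((fun w : ℝ × EuclideanSpace ℝ (Fin 3) => cylRadius w.2) '' S) = 0 := by
  refine le_antisymm (ENNReal.le_of_forall_pos_le_add fun η hη _ => ?_) bot_le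
  rw [zero_add]
  obtain ⟨z, r, hr, hcov, hsum⟩ := SereginSverak2002.exists_cover_of_isParabolicNull hS (half_pos (NNReal.coe_pos.2 hη))
  calc volume ((fun w : ℝ × EuclideanSpace ℝ (Fin 3) => cylRadius w.2) '' S)
      ≤ volume (⋃ i, Icc (cylRadius (z i).2 - r i) (cylRadius (z i).2 + r i)) := by
        refine measure_mono ?_
        refine (image_mono hcov).trans ?_
        rw [image_iUnion]
        exact iUnion_mono fun i => cylRadius_image_cylinder_subset (r i) (z i)
    _ ≤ ∑' i, volume (Icc (cylRadius (z i).2 - r i) (cylRadius (z i).2 + r i)) := measure_iUnion_le _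
    _ = ∑' i, 2 * ENNReal.ofReal (r i) := by
        congr 1; funext i
        rw [Real.volume_Icc, show cylRadius (z i).2 + r i - (cylRadius (z i).2 - r i) = 2 * r i by ring,
          ENNReal.ofReal_mul (by norm_num), ENNReal.ofReal_ofNat]
    _ = 2 * ∑' i, ENNReal.ofReal (r i) := ENNReal.tsum_mul_left
    _ ≤ 2 * ENNReal.ofReal ((η : ℝ) / 2) := by gcongr
    _ = (η : ℝ≥0∞) := by
        rw [ENNReal.ofReal_div_of_pos two_pos, ENNReal.ofReal_ofNat, ENNReal.ofReal_coe_nnreal,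
          ENNReal.mul_div_cancel (by norm_num) (by norm_num)]

/-- **S3 `stub_radialGap` of the N3 skeleton (`Sig.radialGap` verbatim).** A compact `𝒫¹`-null set misses a whole radial band
inside any `]α, β[`. [folklore] -/
theorem radialGap :
    ∀ (S : Set (ℝ × EuclideanSpace ℝ (Fin 3))) (α β : ℝ), IsCompact S → IsParabolicNull 1 S → α < β →
      ∃ a δ : ℝ, 0 < δ ∧ α < a - 2 * δ ∧ a + 2 * δ < β ∧
        ∀ z ∈ S, cylRadius z.2 < a - 2 * δ ∨ a + 2 * δ < cylRadius z.2 := by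
  intro S α β hSc hS0 hαβ
  set N : Set ℝ := (fun w : ℝ × EuclideanSpace ℝ (Fin 3) => cylRadius w.2) '' S with hN
  have hNc : IsCompact N := hSc.image (continuous_cylRadius.comp continuous_snd)
  have hN0 : volume N = 0 := volume_cylRadius_image_eq_zero hS0
  -- a point of `]α, β[` off `N`
  have hne : ¬ (Ioo α β ⊆ N) := by
    intro hsub
    have h1 : volume (Ioo α β) ≤ volume N := measure_mono hsub
    rw [hN0, Real.volume_Ioo, nonpos_iff_eq_zero, ENNReal.ofReal_eq_zero] at h1
    linarith
  obtain ⟨a, haI, haN⟩ := not_subset.1 hne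
  -- an open ball around it off the closed set `N`
  obtain ⟨ε, hε, hball⟩ := Metric.isOpen_iff.1 hNc.isClosed.isOpen_compl a haN
  obtain ⟨δ, hδ⟩ : ∃ x : ℝ, x = min ε (min (a - α) (β - a)) / 4 := ⟨_, rfl⟩
  have hm0 : 0 < min ε (min (a - α) (β - a)) := lt_min hε (lt_min (by linarith [haI.1]) (by linarith [haI.2]))
  have hδ0 : 0 < δ := by rw [hδ]; positivity
  have hδε : 4 * δ ≤ ε := by rw [hδ]; linarith [min_le_left ε (min (a - α) (β - a))]
  have hδα : 4 * δ ≤ a - α := by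
    rw [hδ]; linarith [min_le_right ε (min (a - α) (β - a)), min_le_left (a - α) (β - a)]
  have hδβ : 4 * δ ≤ β - a := by
    rw [hδ]; linarith [min_le_right ε (min (a - α) (β - a)), min_le_right (a - α) (β - a)]
  refine ⟨a, δ, hδ0, by linarith, by linarith, fun z hz => ?_⟩
  have hzN : cylRadius z.2 ∈ N := ⟨z, hz, rfl⟩
  by_contra hcon
  push Not at hcon
  have hin : cylRadius z.2 ∈ ball a ε := by
    rw [mem_ball, Real.dist_eq, abs_lt]
    constructor <;> linarith [hcon.1, hcon.2]
  exact hball hin hzN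

end Summit.NavierStokesRegularity.NavierStokesRegularity.Theorems.AveragedConeLiouville.Shell

end
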